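import Summits.AtomisticToContinuum.BoseEinsteinCondensation.Theses.BECInfraredBound

/-!
# Crux `BecWindowCount` (stmt-AtomisticToContinuum-9015) — `Lines/birth.lean`

BC3 birth skeleton for the rank-9 crux `BecWindowCount` of route `BECInfraredBound`
(sub-problem `BoseEinsteinCondensation`; the crux is wanted by this route only).

**The crux.** For every repulsive finite-range `v`: the WINDOW INFRARED BOUND for `v` (body of the
rank-2 crux `BecIrWindow` after its non-triviality hypothesis: every δ-near-minimiser `Ψ` of the
Dirichlet energy in the box of side `L = (N/ρ)^{1/3}` has inner-box plane-wave occupations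
`⟨φ'_k, γ_Ψ φ'_k⟩ ≤ C(1 + √ρ·L/‖k‖)` for all `k ∈ ℤ³∖0` with `‖k‖ ≤ K√ρ·L`, sup norm) implies that
the infrared window carries an arbitrarily small particle fraction: for all `ε ∈ (0,1/4)`, `K > 0`,
`η > 0` there is `ρ₀` such that for `0 < ρ < ρ₀`, eventually in `N`, some `δ > 0` and every
δ-near-minimiser, `Σ'_{k ≠ 0, ‖k‖ ≤ K√ρL} ⟨φ'_k, γ_Ψ φ'_k⟩ ≤ ηN` (an `ℝ≥0∞` `tsum` over the window
subtype).

## The line: SUM THE PROFILE OVER THE LATTICE WINDOW, THEN LET THE DENSITY ABSORB IT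

Write `s = √ρ·L` and `R = K·s` (the window radius in lattice units). The crux factors through the
number `C · W(R, s)`, where `W(R, s) := Σ_{k ∈ ℤ³, k ≠ 0, ‖k‖∞ ≤ R} (1 + s/‖k‖∞)` is a pure
lattice sum, and two genuinely different facts about it:

* `stub_windowLatticeSum` — GEOMETRY OF NUMBERS (d = 3, sup norm): for all real `R, s ≥ 0`,
  `W(R, s) ≤ (2R+1)³ + 13·s·R(R+1)`, stated in the crux's own currency (an `ℝ≥0∞` `tsum` of
  `ofReal (1 + s/‖k‖)` over the window subtype `{k ≠ 0 ∧ ‖k‖ ≤ R}`). Proof on paper: the shell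
  `‖k‖∞ = m` has `(2m+1)³ − (2m−1)³ = 24m² + 2` points, so `#{0 < ‖k‖∞ ≤ R} = (2⌊R⌋+1)³ − 1` and
  `Σ 1/‖k‖∞ = Σ_{m ≤ ⌊R⌋} (24m + 2/m) ≤ 12n(n+1) + 2n ≤ 13n(n+1)`, `n = ⌊R⌋ ≤ R` (empty for
  `R < 1`). In Lean: finiteness of the window, `tsum` over a finite subtype = `Finset.sum`, the box
  `Finset.Icc (-n) n` on `Fin 3 → ℤ`, shell decomposition — size M, provable now (refuters
  g41-27/g41-12 verified the arithmetic on stmt-8911).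
* `stub_smallDensityAbsorption` — THERMODYNAMIC-LIMIT ARITHMETIC: with `L = sideLength ρ N =
  (N/ρ)^{1/3}` one has `s³ = √ρ·N`, `s² = ρ^{1/3}N^{2/3}`, so
  `C·((2Ks+1)³ + 13·s·Ks·(Ks+1)) = C(8K³+13K²)√ρ·N + C(12K²+13K)ρ^{1/3}N^{2/3} + 6CKρ^{1/6}N^{1/3} + C`;
  hence for every `K, C, η > 0` there is `ρ₀ > 0` (`C(8K³+13K²)√ρ₀ ≤ η/2`) such that for
  `0 < ρ < ρ₀` the bound is `≤ ηN` EVENTUALLY in `N` (the `N^{2/3}` boundary-of-window term is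
  absorbed only eventually — the item's recorded formal risk). Size M: `Real.rpow` algebra and an
  `atTop` domination, provable now.

`BecWindowCount_of : stub₁-sig → stub₂-sig → BecWindowCount` is a REAL PROOF (no `sorry`): take
`ρ₀^IR, C` from the window infrared bound at `(ε, K)`, `ρ₀^abs` from stub 2 at `(K, C, η)`,
`ρ₀ := min`, intersect the two eventualities in `N`, keep the SAME `δ`; then pointwise bound ⇒
`Σ' occ ≤ Σ' ofReal (C(1 + s/‖k‖)) = ofReal C · Σ' ofReal (1 + s/‖k‖) ≤ ofReal (C · W-bound) ≤
ofReal (ηN)` (`tsum_le_ofReal_mul`, `ENNReal.tsum_mul_left`). `BecWindowCount_of_stubs :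
BecWindowCount` feeds the two sorried stubs in (and type-checks that the registered-name aliases
`__Registered.stub_X` ARE the stub statements).

Why this is not shredding: two stubs = the two contents of the item (lattice count; small-density /
large-`N` absorption), each M-sized with its own Lean technology; neither mentions `occupation`,
trial states or energies, so neither is the crux or the summit in costume (BC3 probes
`stub → BecWindowCount`, `stub → BoseEinsteinCondensation` by `first | exact? | simpa | aesop` fail —
see the registrar's NOTES). Disproof used: none on file (`ledger crux ls stmt-AtomisticToContinuum-9015`:
no workfiles before this one). Negatives index: no entry is an instance of either stub.
Degenerate cases: `R < 1` (window empty, stub 1 reads `0 ≤ …`); `N = 0` (`sideLength ρ 0 = 0`,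
stub 2's inequality fails there but is only asked eventually); `η` large (trivial).
-/

namespace Summit.AtomisticToContinuum.BoseEinsteinCondensation.Cruxes.BecWindowCount.Birth

open Filter
open scoped ENNReal


/-! ### The two stubs -/

/-- STUB 1 — LATTICE WINDOW SUM (geometry of numbers in `d = 3`, sup norm; size M, provable now).
For all real `R, s ≥ 0`: `Σ_{k ∈ ℤ³, k ≠ 0, ‖k‖∞ ≤ R} (1 + s/‖k‖∞) ≤ (2R+1)³ + 13·s·R(R+1)`, as an
`ℝ≥0∞` `tsum` over the window subtype (the crux's currency; the window is finite, so the `tsum` is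
a finite sum). Shell count `#{‖k‖∞ = m} = 24m² + 2`; `Σ_{m ≤ n} (24m + 2/m) ≤ 13n(n+1)`, `n = ⌊R⌋`.
[cite: LSSY2005, Ch. 11 (mode counting); DysonLiebSimon1978, §1] -/
theorem stub_windowLatticeSum :
    ∀ R s : ℝ, 0 ≤ R → 0 ≤ s → ∑' k : {k : Fin 3 → ℤ // k ≠ 0 ∧ ‖(fun j => (k j : ℝ))‖ ≤ R}, ENNReal.ofReal (1 + s / ‖(fun j => (k.1 j : ℝ))‖) ≤ ENNReal.ofReal ((2 * R + 1) ^ 3 + 13 * s * R * (R + 1)) := by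
  sorry

/-- STUB 2 — SMALL-DENSITY / LARGE-`N` ABSORPTION (thermodynamic-limit arithmetic; size M,
provable now). With `L = sideLength ρ N = (N/ρ)^{1/3}`, `s = √ρ·L`, `R = K·s`:
`s³ = √ρ·N`, so `C·((2R+1)³ + 13·s·R(R+1)) = C(8K³+13K²)√ρ·N + O_{K,C,ρ}(N^{2/3})`; for every
`K, C, η > 0` there is `ρ₀ > 0` such that for `0 < ρ < ρ₀` this is `≤ ηN` eventually in `N`.
[cite: LSSY2005, §1.2 (thermodynamic limit at fixed density)] -/
theorem stub_smallDensityAbsorption :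
    ∀ K : ℝ, 0 < K → ∀ C : ℝ, 0 < C → ∀ η : ℝ, 0 < η → ∃ ρ₀ : ℝ, 0 < ρ₀ ∧ ∀ ρ : ℝ, 0 < ρ → ρ < ρ₀ → ∀ᶠ N : ℕ in Filter.atTop, C * ((2 * (K * Real.sqrt ρ * Literature.MathematicalPhysics.QuantumManyBody.BoseGas.sideLength ρ N) + 1) ^ 3 + 13 * (Real.sqrt ρ * Literature.MathematicalPhysics.QuantumManyBody.BoseGas.sideLength ρ N) * (K * Real.sqrt ρ * Literature.MathematicalPhysics.QuantumManyBody.BoseGas.sideLength ρ N) * (K * Real.sqrt ρ * Literature.MathematicalPhysics.QuantumManyBody.BoseGas.sideLength ρ N + 1)) ≤ η * N := by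
  sorry

/-! ### Registered-name aliases of the stub statements

The native skeleton audit (`#h21_check_skeleton`, run by `ledger skeleton check`) admits a `Prop`
hypothesis of the skeleton theorem only if its HEAD CONSTANT is a registered obligation or is NAMED
like a declared stub. A verbatim `∀ …` signature has no head constant, so the stubs enter
`BecWindowCount_of` through the aliases below: `__Registered.stub_X` is the statement of `stub_X`,
character for character, under that name (reducible, definitionally equal — `BecWindowCount_of_stubs`
feeds the theorems `stub_X` straight in). The `__` namespace is an implementation detail skipped by
the audit's declaration scan, so the registered stubs remain the sorried THEOREMS `stub_X` with their
full self-contained signatures (same device as `Cruxes/BlockInfraredBound/Lines/birth.lean`). -/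
namespace __Registered

/-- The statement of `stub_windowLatticeSum`, verbatim, keyed by the registered stub name. [folklore] -/
abbrev stub_windowLatticeSum : Prop :=
    ∀ R s : ℝ, 0 ≤ R → 0 ≤ s → ∑' k : {k : Fin 3 → ℤ // k ≠ 0 ∧ ‖(fun j => (k j : ℝ))‖ ≤ R}, ENNReal.ofReal (1 + s / ‖(fun j => (k.1 j : ℝ))‖) ≤ ENNReal.ofReal ((2 * R + 1) ^ 3 + 13 * s * R * (R + 1))

/-- The statement of `stub_smallDensityAbsorption`, verbatim, keyed by the registered stub name. [folklore] -/
abbrev stub_smallDensityAbsorption : Prop :=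
    ∀ K : ℝ, 0 < K → ∀ C : ℝ, 0 < C → ∀ η : ℝ, 0 < η → ∃ ρ₀ : ℝ, 0 < ρ₀ ∧ ∀ ρ : ℝ, 0 < ρ → ρ < ρ₀ → ∀ᶠ N : ℕ in Filter.atTop, C * ((2 * (K * Real.sqrt ρ * Literature.MathematicalPhysics.QuantumManyBody.BoseGas.sideLength ρ N) + 1) ^ 3 + 13 * (Real.sqrt ρ * Literature.MathematicalPhysics.QuantumManyBody.BoseGas.sideLength ρ N) * (K * Real.sqrt ρ * Literature.MathematicalPhysics.QuantumManyBody.BoseGas.sideLength ρ N) * (K * Real.sqrt ρ * Literature.MathematicalPhysics.QuantumManyBody.BoseGas.sideLength ρ N + 1)) ≤ η * N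

end __Registered


/-! ### Elementary lemma used by the assembly (sorry-free) -/

/-- `ℝ≥0∞` bookkeeping: a pointwise bound `f i ≤ ofReal (C · g i)` with `C ≥ 0` and a summed bound
`Σ' ofReal (g i) ≤ ofReal B` give `Σ' f ≤ ofReal (C · B)` (constant out of the `tsum`). [folklore] -/
theorem tsum_le_ofReal_mul {ι : Type*} {f : ι → ℝ≥0∞} {g : ι → ℝ} {C B : ℝ} (hC : 0 ≤ C)
    (hf : ∀ i, f i ≤ ENNReal.ofReal (C * g i))
    (hg : ∑' i, ENNReal.ofReal (g i) ≤ ENNReal.ofReal B) :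
    ∑' i, f i ≤ ENNReal.ofReal (C * B) := by
  calc ∑' i, f i ≤ ∑' i, ENNReal.ofReal (C * g i) := ENNReal.tsum_le_tsum hf
    _ = ∑' i, ENNReal.ofReal C * ENNReal.ofReal (g i) := tsum_congr fun i => ENNReal.ofReal_mul hC
    _ = ENNReal.ofReal C * ∑' i, ENNReal.ofReal (g i) := ENNReal.tsum_mul_left
    _ ≤ ENNReal.ofReal C * ENNReal.ofReal B := mul_le_mul' le_rfl hg
    _ = ENNReal.ofReal (C * B) := (ENNReal.ofReal_mul hC).symm


/-! ### The assembly -/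

/-- THE SKELETON THEOREM, HYPOTHESIS FORM (real proof, no `sorry`): the two stub statements — under
their REGISTERED NAMES `__Registered.stub_windowLatticeSum` / `__Registered.stub_smallDensityAbsorption`,
reducible aliases of the verbatim signatures — imply the crux `BECInfraredBound.BecWindowCount` BY
NAME. Bookkeeping: `ρ₀ := min ρ₀^IR ρ₀^abs`, the two `atTop`-eventualities intersected, the same
`δ` as the infrared bound; analysis: pointwise window bound ⇒ summed bound (`tsum_le_ofReal_mul`)
⇒ stub 1 at `R = K√ρL`, `s = √ρL` ⇒ stub 2. [folklore] -/
theorem BecWindowCount_of :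
    __Registered.stub_windowLatticeSum →
    __Registered.stub_smallDensityAbsorption →
    Summit.AtomisticToContinuum.BoseEinsteinCondensation.Theses.BECInfraredBound.BecWindowCount := by
  intro hS1 hS2 v _hv hIR ε hε hε4 K hK η hη
  obtain ⟨ρ₁, hρ₁, C, hC, H1⟩ := hIR ε hε hε4 K hK
  obtain ⟨ρ₂, hρ₂, H2⟩ := hS2 K hK C hC η hη
  refine ⟨min ρ₁ ρ₂, lt_min hρ₁ hρ₂, ?_⟩
  intro ρ hρ hρlt
  have e1 := H1 ρ hρ (lt_of_lt_of_le hρlt (min_le_left _ _))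
  have e2 := H2 ρ hρ (lt_of_lt_of_le hρlt (min_le_right _ _))
  filter_upwards [e1, e2] with N hN1 hN2
  obtain ⟨δ, hδ, HΨ⟩ := hN1
  refine ⟨δ, hδ, ?_⟩
  intro Ψ hΨ
  have hL0 : 0 ≤ Literature.MathematicalPhysics.QuantumManyBody.BoseGas.sideLength ρ N :=
    Real.rpow_nonneg (div_nonneg (Nat.cast_nonneg N) hρ.le) _
  have hs0 : 0 ≤ Real.sqrt ρ * Literature.MathematicalPhysics.QuantumManyBody.BoseGas.sideLength ρ N :=
    mul_nonneg (Real.sqrt_nonneg ρ) hL0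
  have hR0 : 0 ≤ K * Real.sqrt ρ * Literature.MathematicalPhysics.QuantumManyBody.BoseGas.sideLength ρ N :=
    mul_nonneg (mul_nonneg hK.le (Real.sqrt_nonneg ρ)) hL0
  have key := hS1 (K * Real.sqrt ρ * Literature.MathematicalPhysics.QuantumManyBody.BoseGas.sideLength ρ N)
    (Real.sqrt ρ * Literature.MathematicalPhysics.QuantumManyBody.BoseGas.sideLength ρ N) hR0 hs0
  have hpt := fun k : {k : Fin 3 → ℤ // k ≠ 0 ∧ ‖(fun j => (k j : ℝ))‖ ≤ K * Real.sqrt ρ * Literature.MathematicalPhysics.QuantumManyBody.BoseGas.sideLength ρ N} =>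
    HΨ Ψ hΨ k.1 k.2.1 k.2.2
  have step := tsum_le_ofReal_mul hC.le hpt key
  have fin := step.trans (ENNReal.ofReal_le_ofReal hN2)
  exact fin

/-- THE SKELETON THEOREM, CLOSED FORM: the crux `BECInfraredBound.BecWindowCount` from the two
declared stubs (its only `sorry`s are the stubs'; the composition is `BecWindowCount_of`, and this
line type-checks that each alias `__Registered.stub_X` IS the statement of `stub_X`). [folklore] -/
theorem BecWindowCount_of_stubs :
    Summit.AtomisticToContinuum.BoseEinsteinCondensation.Theses.BECInfraredBound.BecWindowCount :=
  BecWindowCount_of stub_windowLatticeSum stub_smallDensityAbsorption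

end Summit.AtomisticToContinuum.BoseEinsteinCondensation.Cruxes.BecWindowCount.Birth
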